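import Literature.Probability.RandomPlanarGeometry.BrownianExitIntervalMoments
import Literature.Probability.RandomPlanarGeometry.BrownianStrongMarkov
import Literature.Probability.Process.BrownianTimeIntegral
import Literature.Probability.Process.BrownianVec
import HarnessLib

/-!
# The martingales `tB_t − ∫₀ᵗ B_s ds` and `B_t³ − 3∫₀ᵗ B_s ds` (Durrett 2019, §7.6 Exercise 7.6.2)

[topic Probability/Process]

Topic `Probability/Process`, namespace `Literature.Probability.Process`; for the canonical Brownian
motion `B = Process.brownian` under the pre-Wiener measure `P_0 = Process.preWienerMeasure`, its raw
filtration `RandomPlanarGeometry.brownianFiltration`, and the time integral in the convention of the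
tree's Exercise 7.1.3 file (`Process/BrownianTimeIntegral.lean`): `∫₀ᵗ B_s ds` is
`∫ r in Ioc 0 t, brownian r.toNNReal ω`.  THEOREMS ONLY (no definition, no named fact, no instance,
no notation, no axiom).

## The printed statement (R. Durrett, *Probability: Theory and Examples*, 5th ed., CUP 2019, §7.6
## Exercises, book p. 328 = PDF p0340 of the held copy `book:durrett2019-probability-theory-examples`),
## VERBATIM

"**7.6.2** Show that `B_t³ − 3tB_t` and `B_t³ − ∫_0^t 3B_s ds` are a martingale."

## What is typed, and how

| Durrett 2019, §7.6 Exercise 7.6.2 | declaration | status |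
|---|---|---|
| `B_t³ − 3tB_t` is a martingale | the tree's `RandomPlanarGeometry.Durrett2019_thm_7_5_8_cubic` (Theorem 7.5.8 for `x³ − 3tx`) | already in the tree, not restated |
| `∫₀ᵗ B_s ds` is `𝓕_t`-measurable (limit of Riemann sums) and integrable | `stronglyMeasurable_timeIntegral_brownian`, `integrable_timeIntegral_brownian` | proved |
| Fubini over an event: `∫_A ∫_{(a,b]} B_r dr dP_0 = ∫_{(a,b]} ∫_A B_r dP_0 dr` | `setIntegral_timeIntegral_brownian_eq` | proved |
| `tB_t − ∫₀ᵗ B_s ds` (`= ∫₀ᵗ s dB_s`) is a martingale | `martingale_mul_brownian_sub_timeIntegral` | proved |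
| **`B_t³ − 3∫₀ᵗ B_s ds` is a martingale** | `Durrett2019_exercise_7_6_2` | proved |

Method (the book intends Itô's formula; we avoid it, said so): `B_t³ − 3∫₀ᵗ B_s ds =
(B_t³ − 3tB_t) + 3(tB_t − ∫₀ᵗ B_s ds)`, and `L_t = tB_t − ∫₀ᵗ B_s ds` is a martingale by a direct
computation with the martingale `B` (the tree's `martingale_brownian_holds`) and Fubini: for `s ≤ t`
and `A ∈ 𝓕_s`, `∫_A L_t − ∫_A L_s = t∫_A B_t − s∫_A B_s − ∫_{(s,t]} ∫_A B_r dP dr =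
(t − s)∫_A B_s − (t − s)∫_A B_s = 0` (`∫_A B_r = ∫_A B_s` for `r ≥ s`).  Adaptedness of the time
integral: pathwise limit of the `𝓕_t`-measurable Riemann sums (the tree's
`tendsto_riemannSum_of_continuousOn`); its integrability: the tree's joint integrability
`IsPreBrownianReal.integrable_uncurry_restrict_Ioc` (Exercise 7.1.3).

## References

* [Durrett2019] R. Durrett, *Probability: Theory and Examples*, 5th ed., CUP (2019),
  doi:10.1017/9781108591034, §7.6 Exercise 7.6.2 (p. 328, PDF p0340); Theorem 7.5.8; Exercise 7.1.3.
-/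

noncomputable section

open MeasureTheory ProbabilityTheory Filter Set
open scoped NNReal ENNReal Topology

namespace Literature.Probability.Process

/-! ### §1 The time integral `∫₀ᵗ B_s ds`: continuity, adaptedness, integrability, Fubini -/

/-- The Brownian path read at real times, `r ↦ B_{r⁺}`, is continuous. [folklore] -/
private theorem continuous_brownian_toNNReal (ω : ℝ≥0 → ℝ) :
    Continuous fun r : ℝ ↦ brownian r.toNNReal ω :=
  (continuous_brownian ω).comp continuous_real_toNNReal

/-- `B_{r⁺}` is `𝓕_t`-measurable for `r ≤ t`. [folklore] -/
private theorem measurable_brownian_toNNReal_of_le {r : ℝ} {t : ℝ≥0} (h : r ≤ t) :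
    Measurable[RandomPlanarGeometry.brownianFiltration t] (brownian r.toNNReal) :=
  (RandomPlanarGeometry.adapted_brownian r.toNNReal).mono
    (RandomPlanarGeometry.brownianFiltration.mono (Real.toNNReal_le_iff_le_coe.2 h)) le_rfl

/-- **`∫₀ᵗ B_s ds` is `𝓕_t`-measurable**: it is the pathwise limit of the Riemann sums
`∑_{k<n} (t/n) B_{kt/n}`, each `𝓕_t`-measurable. [cite: Durrett2019, §7.6 Exercise 7.6.2 and Exercise 7.1.3] -/
theorem stronglyMeasurable_timeIntegral_brownian (t : ℝ≥0) :
    StronglyMeasurable[RandomPlanarGeometry.brownianFiltration t]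
      fun ω ↦ ∫ r in Ioc 0 (t : ℝ), brownian r.toNNReal ω := by
  set R : ℕ → (ℝ≥0 → ℝ) → ℝ := fun n ω ↦ ∑ k ∈ Finset.range n,
    ((t : ℝ) - 0) / n * brownian ((0 : ℝ) + k * (((t : ℝ) - 0) / n)).toNNReal ω with hR
  have hRm : ∀ n, Measurable[RandomPlanarGeometry.brownianFiltration t] (R n) := by
    intro n
    refine Finset.measurable_sum _ fun k hk ↦ Measurable.const_mul ?_ _
    rw [Finset.mem_range] at hk
    refine measurable_brownian_toNNReal_of_le ?_
    have hn : (0 : ℝ) < n := by exact_mod_cast (Nat.zero_le k).trans_lt hk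
    have hk' : (k : ℝ) ≤ n := by exact_mod_cast hk.le
    have ht : (0 : ℝ) ≤ t := t.coe_nonneg
    rw [sub_zero, zero_add]
    calc (k : ℝ) * ((t : ℝ) / n) = (k / n) * t := by ring
      _ ≤ 1 * t := by gcongr; rwa [div_le_one hn]
      _ = t := one_mul _
  have hlim : Tendsto R atTop (𝓝 fun ω ↦ ∫ r in Ioc 0 (t : ℝ), brownian r.toNNReal ω) := by
    rw [tendsto_pi_nhds]
    intro ω
    have h := tendsto_riemannSum_of_continuousOn t.coe_nonneg
      (continuous_brownian_toNNReal ω).continuousOn (a := 0) (b := (t : ℝ))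
    rw [intervalIntegral.integral_of_le t.coe_nonneg] at h
    exact h
  exact stronglyMeasurable_of_tendsto atTop (fun n ↦ (hRm n).stronglyMeasurable) hlim

/-- Joint integrability of `(r, ω) ↦ B_{r⁺}(ω)` on `(a, b] × A` (`0 ≤ a`), from the tree's
`IsPreBrownianReal.integrable_uncurry_restrict_Ioc`. [folklore] -/
private theorem integrable_uncurry_brownian_restrict {a b : ℝ} (ha : 0 ≤ a) (A : Set (ℝ≥0 → ℝ)) :
    Integrable (Function.uncurry fun (r : ℝ) (ω : ℝ≥0 → ℝ) ↦ brownian r.toNNReal ω)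
      ((volume.restrict (Ioc a b)).prod (preWienerMeasure.restrict A)) := by
  haveI := RandomPlanarGeometry.isProbabilityMeasure_preWienerMeasure'
  exact (RandomPlanarGeometry.isPreBrownianReal_brownian.integrable_uncurry_restrict_Ioc
    RandomPlanarGeometry.measurable_uncurry_brownian b).mono_measure
    (Measure.prod_mono (Measure.restrict_mono (Ioc_subset_Ioc_left ha) le_rfl)
      Measure.restrict_le_self)

/-- **`∫₀ᵗ B_s ds` is integrable** under `P_0` (Fubini; `E|B_s| ≤ (1+s)/2`).
[cite: Durrett2019, Exercise 7.1.3] -/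
theorem integrable_timeIntegral_brownian (t : ℝ) :
    Integrable (fun ω ↦ ∫ r in Ioc 0 t, brownian r.toNNReal ω) preWienerMeasure := by
  haveI := RandomPlanarGeometry.isProbabilityMeasure_preWienerMeasure'
  exact (RandomPlanarGeometry.isPreBrownianReal_brownian.integrable_uncurry_restrict_Ioc
    RandomPlanarGeometry.measurable_uncurry_brownian t).integral_prod_right

/-- **Fubini over an event**: `∫_A (∫_{(a,b]} B_r dr) dP_0 = ∫_{(a,b]} (∫_A B_r dP_0) dr` (`0 ≤ a`).
[cite: Durrett2019, Exercise 7.1.3] -/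
theorem setIntegral_timeIntegral_brownian_eq {a b : ℝ} (ha : 0 ≤ a) (A : Set (ℝ≥0 → ℝ)) :
    ∫ ω in A, (∫ r in Ioc a b, brownian r.toNNReal ω) ∂preWienerMeasure =
      ∫ r in Ioc a b, (∫ ω in A, brownian r.toNNReal ω ∂preWienerMeasure) := by
  haveI := RandomPlanarGeometry.isProbabilityMeasure_preWienerMeasure'
  exact (integral_integral_swap (integrable_uncurry_brownian_restrict ha A (b := b))).symm

/-- Integrability of `∫_{(a,b]} B_r dr` on an event (`0 ≤ a`). [folklore] -/
private theorem integrable_timeIntegral_Ioc_restrict {a b : ℝ} (ha : 0 ≤ a) (A : Set (ℝ≥0 → ℝ)) :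
    Integrable (fun ω ↦ ∫ r in Ioc a b, brownian r.toNNReal ω) (preWienerMeasure.restrict A) := by
  haveI := RandomPlanarGeometry.isProbabilityMeasure_preWienerMeasure'
  exact (integrable_uncurry_brownian_restrict ha A (b := b)).integral_prod_right

/-- Pathwise additivity: `∫_{(0,t]} B_r dr = ∫_{(0,s]} B_r dr + ∫_{(s,t]} B_r dr` for `0 ≤ s ≤ t`
(the path is continuous). [folklore] -/
private theorem timeIntegral_split {s t : ℝ} (hs : 0 ≤ s) (hst : s ≤ t) (ω : ℝ≥0 → ℝ) :
    ∫ r in Ioc 0 t, brownian r.toNNReal ω =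
      (∫ r in Ioc 0 s, brownian r.toNNReal ω) + ∫ r in Ioc s t, brownian r.toNNReal ω := by
  have hc := continuous_brownian_toNNReal ω
  rw [← intervalIntegral.integral_of_le hs, ← intervalIntegral.integral_of_le hst,
    ← intervalIntegral.integral_of_le (hs.trans hst),
    intervalIntegral.integral_add_adjacent_intervals (hc.intervalIntegrable _ _)
      (hc.intervalIntegrable _ _)]

/-! ### §2 The martingale `tB_t − ∫₀ᵗ B_s ds` -/

/-- **`L_t = tB_t − ∫₀ᵗ B_s ds` is a martingale** of the raw Brownian filtration (it is the Wiener
integral `∫₀ᵗ s dB_s`; here: for `s ≤ t`, `A ∈ 𝓕_s`,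
`∫_A L_t − ∫_A L_s = (t − s)∫_A B_s − ∫_{(s,t]} ∫_A B_r dP dr = 0` since `∫_A B_r = ∫_A B_s`, `r ≥ s`).
It is one third of the difference of the two martingales of Exercise 7.6.2.
[cite: Durrett2019, §7.6 Exercise 7.6.2] -/
theorem martingale_mul_brownian_sub_timeIntegral :
    Martingale (fun (t : ℝ≥0) (ω : ℝ≥0 → ℝ) ↦
        (t : ℝ) * brownian t ω - ∫ r in Ioc 0 (t : ℝ), brownian r.toNNReal ω)
      RandomPlanarGeometry.brownianFiltration preWienerMeasure := by
  haveI := RandomPlanarGeometry.isProbabilityMeasure_preWienerMeasure'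
  have hadapt : ∀ t : ℝ≥0, StronglyMeasurable[RandomPlanarGeometry.brownianFiltration t]
      (fun ω ↦ (t : ℝ) * brownian t ω - ∫ r in Ioc 0 (t : ℝ), brownian r.toNNReal ω) := fun t ↦
    ((RandomPlanarGeometry.stronglyAdapted_brownian t).const_mul _).sub
      (stronglyMeasurable_timeIntegral_brownian t)
  have hint : ∀ t : ℝ≥0, Integrable
      (fun ω ↦ (t : ℝ) * brownian t ω - ∫ r in Ioc 0 (t : ℝ), brownian r.toNNReal ω)
      preWienerMeasure := fun t ↦
    ((RandomPlanarGeometry.integrable_brownian t).const_mul _).sub (integrable_timeIntegral_brownian _)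
  refine ⟨hadapt, fun s t hst ↦ ?_⟩
  refine (ae_eq_condExp_of_forall_setIntegral_eq (RandomPlanarGeometry.brownianFiltration.le s)
    (hint t) (fun A _ _ ↦ (hint s).integrableOn) (fun A hA _ ↦ ?_)
    (hadapt s).aestronglyMeasurable).symm
  have hB := RandomPlanarGeometry.martingale_brownian_holds
  have hst' : (s : ℝ) ≤ t := NNReal.coe_le_coe.2 hst
  -- `∫_A B_t = ∫_A B_s`, and `∫_A B_r = ∫_A B_s` for `r ∈ (s, t]`
  have hAt : ∫ ω in A, brownian t ω ∂preWienerMeasure = ∫ ω in A, brownian s ω ∂preWienerMeasure :=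
    (hB.setIntegral_eq hst hA).symm
  have hAr : ∀ r ∈ Ioc (s : ℝ) t, ∫ ω in A, brownian r.toNNReal ω ∂preWienerMeasure =
      ∫ ω in A, brownian s ω ∂preWienerMeasure := fun r hr ↦ by
    have hsr : s ≤ r.toNNReal := by
      rw [← Real.toNNReal_coe (r := s)]
      exact Real.toNNReal_le_toNNReal hr.1.le
    exact (hB.setIntegral_eq hsr hA).symm
  -- the time integral over `A`
  have hIt : ∫ ω in A, (∫ r in Ioc 0 (t : ℝ), brownian r.toNNReal ω) ∂preWienerMeasure =
      (∫ ω in A, (∫ r in Ioc 0 (s : ℝ), brownian r.toNNReal ω) ∂preWienerMeasure) +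
        ((t : ℝ) - s) * ∫ ω in A, brownian s ω ∂preWienerMeasure := by
    have h1 : (fun ω ↦ ∫ r in Ioc 0 (t : ℝ), brownian r.toNNReal ω) = fun ω ↦
        (∫ r in Ioc 0 (s : ℝ), brownian r.toNNReal ω) + ∫ r in Ioc (s : ℝ) t, brownian r.toNNReal ω := by
      funext ω
      exact timeIntegral_split s.coe_nonneg hst' ω
    rw [h1, integral_add (integrable_timeIntegral_brownian _).integrableOn
      (integrable_timeIntegral_Ioc_restrict s.coe_nonneg A),
      setIntegral_timeIntegral_brownian_eq s.coe_nonneg A,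
      setIntegral_congr_fun measurableSet_Ioc hAr, setIntegral_const, Real.volume_real_Ioc_of_le hst',
      smul_eq_mul]
  rw [integral_sub ((RandomPlanarGeometry.integrable_brownian s).const_mul _).integrableOn
      (integrable_timeIntegral_brownian _).integrableOn,
    integral_sub ((RandomPlanarGeometry.integrable_brownian t).const_mul _).integrableOn
      (integrable_timeIntegral_brownian _).integrableOn,
    integral_const_mul, integral_const_mul, hAt, hIt]
  ring

/-! ### §3 Exercise 7.6.2: `B_t³ − 3∫₀ᵗ B_s ds` is a martingale -/

/-- **Durrett, Exercise 7.6.2 (second martingale)**: "`B_t³ − ∫_0^t 3B_s ds` [is] a martingale"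
(raw Brownian filtration, `P_0`).  Here without Itô's formula: it is the sum of the martingale
`B_t³ − 3tB_t` of Theorem 7.5.8 (the first martingale of the exercise, the tree's
`Durrett2019_thm_7_5_8_cubic`) and `3(tB_t − ∫₀ᵗ B_s ds)`. [cite: Durrett2019, §7.6 Exercise 7.6.2] -/
theorem Durrett2019_exercise_7_6_2 :
    Martingale (fun (t : ℝ≥0) (ω : ℝ≥0 → ℝ) ↦
        brownian t ω ^ 3 - 3 * ∫ r in Ioc 0 (t : ℝ), brownian r.toNNReal ω)
      RandomPlanarGeometry.brownianFiltration preWienerMeasure := by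
  have h := RandomPlanarGeometry.Durrett2019_thm_7_5_8_cubic.add
    (martingale_mul_brownian_sub_timeIntegral.smul 3)
  have heq : (fun (t : ℝ≥0) (ω : ℝ≥0 → ℝ) ↦
      brownian t ω ^ 3 - 3 * ∫ r in Ioc 0 (t : ℝ), brownian r.toNNReal ω) =
      (fun (t : ℝ≥0) (ω : ℝ≥0 → ℝ) ↦ brownian t ω ^ 3 - 3 * (t : ℝ) * brownian t ω) +
        (3 : ℝ) • fun (t : ℝ≥0) (ω : ℝ≥0 → ℝ) ↦
          (t : ℝ) * brownian t ω - ∫ r in Ioc 0 (t : ℝ), brownian r.toNNReal ω := by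
    funext t ω
    simp only [Pi.add_apply, Pi.smul_apply, smul_eq_mul]
    ring
  rw [heq]
  exact h

end Literature.Probability.Process
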